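import Mathlib
import HarnessLib
import Literature.Analysis.UnboundedOperators.HeatKernelCommutator
import Literature.Analysis.UnboundedOperators.HeatKernelGradient
import Summits.NavierStokesRegularity.NavierStokesRegularity.Theorems.HalfSpaceWindowDoorCirculationCarryingRigidityGaussExtremalConditions

/-!
# Route `HalfSpaceWindowDoor`, crux `CirculationCarryingRigidity` (stmt-NavierStokesRegularity-25311) —
# CENTERING at the Gaussian-extremal point: the Gaussian barycentre of `ω₃` sits on the extremal axis point

LEAD ns-hsw-p1 g7 (cell pub-ns-dss), `--supports stmt-NavierStokesRegularity-25311 --as helper`; completes the first-order system of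
`…GaussExtremalConditions` (p669754) with the GRADIENT condition of the axis maximality (E1).  Since `Θ(1,·) = e^{Δ}ω₃` is smooth
(`contDiff_heatExtension_of_bound`) and maximal at `0`, `∇Θ(1,·)(0) = 0` (`IsLocalMax.hasFDerivAt_eq_zero`); the kernel form of the gradient
(`fderiv_heatExtension_apply_eq_integral_of_bound`, `∇G_t(z) = −G_t(z) z/(2t)`) turns this into three more moment identities:

* `integral_heatKernel_inner_mul_eq_zero_of_axisMax` — for any door-class slice whose heat-smoothed `e₃`-vorticity `Θ(1,·)` is maximal at
  `0`: `∫ G₁(y) ⟪y, v⟫ ω₃(y) dy = 0` for every `v ∈ ℝ³` (the Gaussian BARYCENTRE of `ω₃ ≥ 0` is the origin — horizontally AND vertically);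
* `gaussExtremal_firstOrder_joint` — the JOINT first-order system for ONE extremal profile `W` of every enemy of W6: (E0) `Θ(1,0) > 0`,
  (E1) axis maximality + `ΔΘ ≤ 0` + centering `∫G₁⟪y,v⟫ω₃ = 0`, (E2) scale maximality + `Θ + ΔΘ ≥ 0`, (E3) `ℐ(1;0)[W(−1)] = −2·(4π)^{3/2}·2·Θ(1,0)`;
  the moment window `2 ≤ ⟨‖y‖²⟩ ≤ 6` (`…GaussExtremalMoments`) and the tilting window (`…GaussExtremalTilting`) are consequences for the
  same `W`;
* `hemisphereLiouvilleE3_of_firstOrder_joint` — the corresponding reduction of W6.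

WHAT THIS IS NOT: not a statement about Navier–Stokes regularity; door statements concern HYPOTHETICAL blow-up profiles.  No item is
closed by this file.
-/

noncomputable section

-- the summit and its single sub-problem share the name (CONVENTIONS §1), as in every Theorems file
set_option linter.dupNamespace false

namespace Summit.NavierStokesRegularity.NavierStokesRegularity.Theorems.HalfSpaceWindowDoorCirculationCarryingRigidityGaussExtremalCentering

open MeasureTheory Set Function Filter Topology
open scoped RealInnerProductSpace InnerProductSpace Laplacian
open Literature.Analysis Literature.Analysis.FluidPDE Literature.Analysis.UnboundedOperators
open Summit.NavierStokesRegularity.NavierStokesRegularity.Theses.HalfSpaceWindowDoor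
open Summit.NavierStokesRegularity.NavierStokesRegularity.Theorems.HalfSpaceWindowDoorCirculationCarryingRigidityDefs
open Summit.NavierStokesRegularity.NavierStokesRegularity.Theorems.HalfSpaceWindowDoorCirculationCarryingRigidityReduction
  (circulationCarryingRigidity_of_hemisphereLiouvilleE3)
open Summit.NavierStokesRegularity.NavierStokesRegularity.Theorems.HalfSpaceWindowDoorCirculationCarryingRigidityGaussExtremalConditions
  (gaussExtremal_conditions omega3_continuous_bounded)

variable {C : ℝ}

/-- **Gaussian barycentre at an axis maximum.**  Let `W` be a door-class profile and `ω := ⟪curl W(−1), e₃⟫`.  If `y ↦ (e^{Δ}ω)(y)` is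
maximal at `0`, then `∫ G₁(y) ⟪y, v⟫ ω(y) dy = 0` for every `v` (`G₁ = heatKernel 1`). -/
theorem integral_heatKernel_inner_mul_eq_zero_of_axisMax {W : ℝ → EuclideanSpace ℝ (Fin 3) → EuclideanSpace ℝ (Fin 3)}
    (hW : InDoorClass C W)
    (hmax : ∀ y, heatExtension (fun x => ⟪curl (W (-1)) x, e3⟫) 1 y ≤ heatExtension (fun x => ⟪curl (W (-1)) x, e3⟫) 1 0)
    (v : EuclideanSpace ℝ (Fin 3)) :
    ∫ y, heatKernel 1 y * ⟪y, v⟫ * ⟪curl (W (-1)) y, e3⟫ = 0 := by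
  set ω : EuclideanSpace ℝ (Fin 3) → ℝ := fun x => ⟪curl (W (-1)) x, e3⟫ with hω
  obtain ⟨hωc', B, hωB'⟩ := omega3_continuous_bounded hW (by norm_num : (-1 : ℝ) < 0)
  have hωc : Continuous ω := hωc'
  have hωB : ∀ x, ‖ω x‖ ≤ B := hωB'
  -- Fermat: the gradient of `e^{Δ}ω` vanishes at the maximum `0`
  have hdiff : DifferentiableAt ℝ (heatExtension ω 1) 0 :=
    ((contDiff_heatExtension_of_bound hωc hωB one_pos (m := 1)).differentiable one_ne_zero).differentiableAt
  have hloc : IsLocalMax (heatExtension ω 1) 0 := Eventually.of_forall fun y => hmax y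
  have hzero : fderiv ℝ (heatExtension ω 1) 0 = 0 := hloc.fderiv_eq_zero
  have happ : fderiv ℝ (heatExtension ω 1) 0 v = 0 := by rw [hzero]; rfl
  -- kernel form of the gradient
  rw [fderiv_heatExtension_apply_eq_integral_of_bound hωc hωB one_pos 0 v] at happ
  have hker : ∀ y : EuclideanSpace ℝ (Fin 3), (fderiv ℝ (heatKernel 1) (0 - y) v) • ω y =
      (1 / 2 : ℝ) * (heatKernel 1 y * ⟪y, v⟫ * ω y) := by
    intro y
    rw [(hasFDerivAt_heatKernel 1 (0 - y)).fderiv, zero_sub, smul_eq_mul]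
    simp only [smul_apply, innerSL_apply_apply, smul_eq_mul, inner_neg_left]
    have hsym : heatKernel 1 (-y) = heatKernel 1 y := by unfold heatKernel; rw [norm_neg]
    rw [hsym]; ring
  simp_rw [hker, integral_const_mul] at happ
  have h := happ
  simpa using h

/-- **THE JOINT FIRST-ORDER SYSTEM for one extremal profile.**  If W6 fails at constant `C`, there is a closed-hemisphere door-class `W`
(constant `C`), `ω := ⟪curl W(−1), e₃⟫`, `Θ := e^{tΔ}ω`, with: `Θ(1,0) > 0`; `Θ(1,y) ≤ Θ(1,0)` for all `y`; `tΘ(t,0) ≤ Θ(1,0)` for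
`0 < t ≤ 1`; `ΔΘ(1,·)(0) ≤ 0`; `Θ(1,0) + ΔΘ(1,·)(0) ≥ 0`; the CENTERING `∫G₁⟪y,v⟫ω = 0` for all `v`; and
`ℐ(1;0)[W(−1)] = −2·(4π)^{3/2}·2·Θ(1,0)`. -/
theorem gaussExtremal_firstOrder_joint {v : ℝ → EuclideanSpace ℝ (Fin 3) → EuclideanSpace ℝ (Fin 3)} (hv : InDoorClass C v)
    (hsign : SignE3 v) (hpos : ∃ s < 0, ∃ y, 0 < ⟪curl (v s) y, e3⟫) :
    ∃ W : ℝ → EuclideanSpace ℝ (Fin 3) → EuclideanSpace ℝ (Fin 3), InDoorClass C W ∧ SignE3 W ∧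
      0 < heatExtension (fun x => ⟪curl (W (-1)) x, e3⟫) 1 0 ∧
      (∀ y, heatExtension (fun x => ⟪curl (W (-1)) x, e3⟫) 1 y ≤ heatExtension (fun x => ⟪curl (W (-1)) x, e3⟫) 1 0) ∧
      (∀ t : ℝ, 0 < t → t ≤ 1 →
        t * heatExtension (fun x => ⟪curl (W (-1)) x, e3⟫) t 0 ≤ heatExtension (fun x => ⟪curl (W (-1)) x, e3⟫) 1 0) ∧
      (Δ (heatExtension (fun x => ⟪curl (W (-1)) x, e3⟫) 1)) 0 ≤ 0 ∧
      0 ≤ heatExtension (fun x => ⟪curl (W (-1)) x, e3⟫) 1 0 + (Δ (heatExtension (fun x => ⟪curl (W (-1)) x, e3⟫) 1)) 0 ∧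
      (∀ u : EuclideanSpace ℝ (Fin 3), ∫ y, heatKernel 1 y * ⟪y, u⟫ * ⟪curl (W (-1)) y, e3⟫ = 0) ∧
      gaussInflow 1 0 (W (-1)) =
        -2 * ((4 * Real.pi) ^ ((3 : ℝ) / 2) * 2 * heatExtension (fun x => ⟪curl (W (-1)) x, e3⟫) 1 0) := by
  obtain ⟨W, hW, hWs, h0, h1, h2, h3, h4, h5⟩ := gaussExtremal_conditions hv hsign hpos
  exact ⟨W, hW, hWs, h0, h1, h2, h3, h4, fun u => integral_heatKernel_inner_mul_eq_zero_of_axisMax hW h1 u, h5⟩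

/-- **REDUCTION: W6 from the joint first-order system.** -/
theorem hemisphereLiouvilleE3_of_firstOrder_joint
    (h : ∀ (C : ℝ) (W : ℝ → EuclideanSpace ℝ (Fin 3) → EuclideanSpace ℝ (Fin 3)), InDoorClass C W → SignE3 W →
      0 < heatExtension (fun x => ⟪curl (W (-1)) x, e3⟫) 1 0 →
      (∀ y, heatExtension (fun x => ⟪curl (W (-1)) x, e3⟫) 1 y ≤ heatExtension (fun x => ⟪curl (W (-1)) x, e3⟫) 1 0) →
      (∀ t : ℝ, 0 < t → t ≤ 1 →
        t * heatExtension (fun x => ⟪curl (W (-1)) x, e3⟫) t 0 ≤ heatExtension (fun x => ⟪curl (W (-1)) x, e3⟫) 1 0) →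
      (Δ (heatExtension (fun x => ⟪curl (W (-1)) x, e3⟫) 1)) 0 ≤ 0 →
      0 ≤ heatExtension (fun x => ⟪curl (W (-1)) x, e3⟫) 1 0 + (Δ (heatExtension (fun x => ⟪curl (W (-1)) x, e3⟫) 1)) 0 →
      (∀ u : EuclideanSpace ℝ (Fin 3), ∫ y, heatKernel 1 y * ⟪y, u⟫ * ⟪curl (W (-1)) y, e3⟫ = 0) →
      gaussInflow 1 0 (W (-1)) =
        -2 * ((4 * Real.pi) ^ ((3 : ℝ) / 2) * 2 * heatExtension (fun x => ⟪curl (W (-1)) x, e3⟫) 1 0) → False) :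
    HemisphereLiouvilleE3 := by
  intro C v hrate hcont hmild hdiv hsign s hs y
  by_contra hne
  have hpos : 0 < ⟪curl (v s) y, e3⟫ := lt_of_le_of_ne (hsign s hs y) (Ne.symm hne)
  obtain ⟨W, hW, hWs, h0, h1, h2, h3, h4, h5, h6⟩ :=
    gaussExtremal_firstOrder_joint (C := C) ⟨hrate, hcont, hmild, hdiv⟩ hsign ⟨s, hs, y, hpos⟩
  exact h C W hW hWs h0 h1 h2 h3 h4 h5 h6

/-- **The crux from the joint first-order system** (composition with the landed plumbing `stub_rotate`). -/
theorem circulationCarryingRigidity_of_firstOrder_joint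
    (h : ∀ (C : ℝ) (W : ℝ → EuclideanSpace ℝ (Fin 3) → EuclideanSpace ℝ (Fin 3)), InDoorClass C W → SignE3 W →
      0 < heatExtension (fun x => ⟪curl (W (-1)) x, e3⟫) 1 0 →
      (∀ y, heatExtension (fun x => ⟪curl (W (-1)) x, e3⟫) 1 y ≤ heatExtension (fun x => ⟪curl (W (-1)) x, e3⟫) 1 0) →
      (∀ t : ℝ, 0 < t → t ≤ 1 →
        t * heatExtension (fun x => ⟪curl (W (-1)) x, e3⟫) t 0 ≤ heatExtension (fun x => ⟪curl (W (-1)) x, e3⟫) 1 0) →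
      (Δ (heatExtension (fun x => ⟪curl (W (-1)) x, e3⟫) 1)) 0 ≤ 0 →
      0 ≤ heatExtension (fun x => ⟪curl (W (-1)) x, e3⟫) 1 0 + (Δ (heatExtension (fun x => ⟪curl (W (-1)) x, e3⟫) 1)) 0 →
      (∀ u : EuclideanSpace ℝ (Fin 3), ∫ y, heatKernel 1 y * ⟪y, u⟫ * ⟪curl (W (-1)) y, e3⟫ = 0) →
      gaussInflow 1 0 (W (-1)) =
        -2 * ((4 * Real.pi) ^ ((3 : ℝ) / 2) * 2 * heatExtension (fun x => ⟪curl (W (-1)) x, e3⟫) 1 0) → False) :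
    CirculationCarryingRigidity :=
  circulationCarryingRigidity_of_hemisphereLiouvilleE3 (hemisphereLiouvilleE3_of_firstOrder_joint h)

end Summit.NavierStokesRegularity.NavierStokesRegularity.Theorems.HalfSpaceWindowDoorCirculationCarryingRigidityGaussExtremalCentering

end
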